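import Mathlib
import Literature.Analysis.FluidPDE.LerayEnstrophyAPrioriForced
import Literature.Analysis.FluidPDE.SpaceTimeCalculus
import HarnessLib

/-!
# The gradient-energy balance of a uniformly Schwartz field on a closed slab, planar case
  (tools for item stmt-NavierStokesRegularity-1446, `QuasipotentialCoercivity.TwoDimensionalActionBound`)

For `u : ℝ → ℝ² → ℝ²` jointly smooth on `[0, T] × ℝ²` (`T > 0`) with uniform Schwartz decay of all
space–time derivatives (`HasUniformRapidDecayOn (Icc 0 T) u`), the gradient energy
`G(t) = ∫ |∇u(t)|²_F` satisfies, with `W = ∂ₜu` (one-sided within `[0, T]`) and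
`Φ(t) = ∫ 2 Σᵢ ⟪∂ᵢu(t), ∂ᵢW(t)⟫`,

  `G(b) = G(0) + ∫₀ᵇ Φ`  for every `b ∈ (0, T]`

(pointwise `d/dt |∇u(t,x)|² = 2Σᵢ⟪∂ᵢu, ∂ᵢ∂ₜu⟫` at interior times, the fundamental theorem of
calculus in `t` for each `x`, and Fubini). This is the `ℝ²` twin of the tree's `ℝ³` lemma
`Literature.Analysis.FluidPDE.IsSmoothSpaceTimeOn.enstrophy_balance` (`SerrinEnstrophyGronwall`),
whose proof is repeated verbatim with `Fin 3 ↦ Fin 2`; the `L^∞_t L²_x` hypotheses on `∇u`, `∇∂ₜu`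
are read off from the Schwartz bounds
(`HasUniformRapidDecayOn.exists_lintegral_iteratedFDeriv_slice_sq_le_Icc`). No equation is involved.

HONEST FRAMING: calculus bookkeeping for a 2-D calibration inequality; nothing here bears on
Navier–Stokes regularity.

## References
* P. G. Lemarié-Rieusset, *The Navier–Stokes Problem in the 21st Century*, CRC (2016), (7.20).
* A. J. Majda, A. L. Bertozzi, *Vorticity and Incompressible Flow*, CUP (2002), §1.7.
-/

noncomputable section

set_option linter.dupNamespace false

namespace Summit.NavierStokesRegularity.NavierStokesRegularity.Theorems

open Set MeasureTheory Filter Topology Function InnerProductSpace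
open scoped ENNReal NNReal RealInnerProductSpace ContDiff
open Literature.Analysis.FluidPDE

namespace TwoDimActionBound

/-- Derivative of the Frobenius norm along a differentiable family of linear maps on `(EuclideanSpace ℝ (Fin 2))`:
`d/dt |L(t)|² = 2 Σᵢ ⟪L(t) eᵢ, L'(t) eᵢ⟫` (planar twin of the tree's `hasDerivAt_frobeniusNormSq`). [folklore] -/
theorem hasDerivAt_frobeniusNormSq₂ {F : Type*} [NormedAddCommGroup F] [InnerProductSpace ℝ F]
    [FiniteDimensional ℝ F] {L : ℝ → (EuclideanSpace ℝ (Fin 2)) →L[ℝ] F}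
    {L' : (EuclideanSpace ℝ (Fin 2)) →L[ℝ] F} {t : ℝ} (hL : HasDerivAt L L' t) :
    HasDerivAt (fun s => frobeniusNormSq (L s))
      (2 * ∑ i, ⟪L t (EuclideanSpace.basisFun (Fin 2) ℝ i),
        L' (EuclideanSpace.basisFun (Fin 2) ℝ i)⟫) t := by
  have hfun : (fun s => frobeniusNormSq (L s)) =
      fun s => ∑ i, ‖L s (EuclideanSpace.basisFun (Fin 2) ℝ i)‖ ^ 2 := by
    funext s
    exact frobeniusNormSq_eq_sum (EuclideanSpace.basisFun (Fin 2) ℝ) (L s)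
  rw [hfun, Finset.mul_sum]
  refine HasDerivAt.fun_sum fun i _ => ?_
  have h1 : HasDerivAt (fun s => L s (EuclideanSpace.basisFun (Fin 2) ℝ i))
      (L' (EuclideanSpace.basisFun (Fin 2) ℝ i)) t := by
    simpa using hL.clm_apply (hasDerivAt_const t (EuclideanSpace.basisFun (Fin 2) ℝ i))
  exact h1.norm_sq

/-- `ofReal |L|² ≤ 2 ‖L‖ₑ²` on `(EuclideanSpace ℝ (Fin 2))`. [folklore] -/
theorem ofReal_frobeniusNormSq_le_two_mul_enorm_sq {F : Type*} [NormedAddCommGroup F]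
    [InnerProductSpace ℝ F] [FiniteDimensional ℝ F] (L : (EuclideanSpace ℝ (Fin 2)) →L[ℝ] F) :
    ENNReal.ofReal (frobeniusNormSq L) ≤ 2 * ‖L‖ₑ ^ 2 := by
  have h2 : frobeniusNormSq L ≤ 2 * ‖L‖ ^ 2 := by
    rw [frobeniusNormSq_eq_sum (EuclideanSpace.basisFun (Fin 2) ℝ)]
    simpa using sum_sq_norm_apply_le_card_mul_sq_opNorm (EuclideanSpace.basisFun (Fin 2) ℝ) L
  calc ENNReal.ofReal (frobeniusNormSq L) ≤ ENNReal.ofReal (2 * ‖L‖ ^ 2) :=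
        ENNReal.ofReal_le_ofReal h2
    _ = 2 * ‖L‖ₑ ^ 2 := by
        rw [ENNReal.ofReal_mul (by norm_num), ENNReal.ofReal_pow (norm_nonneg _), ofReal_norm]
        norm_num

/-- `‖L‖ₑ² ≤ ofReal |L|²` (operator norm versus Frobenius norm) on `(EuclideanSpace ℝ (Fin 2))`. [folklore] -/
theorem enorm_sq_le_ofReal_frobeniusNormSq₂ {F : Type*} [NormedAddCommGroup F]
    [InnerProductSpace ℝ F] (L : (EuclideanSpace ℝ (Fin 2)) →L[ℝ] F) :
    ‖L‖ₑ ^ 2 ≤ ENNReal.ofReal (frobeniusNormSq L) := by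
  rw [← ofReal_norm, ← ENNReal.ofReal_pow (norm_nonneg _)]
  exact ENNReal.ofReal_le_ofReal (sq_opNorm_le_frobeniusNormSq L)

/-- A continuous nonnegative function on `(EuclideanSpace ℝ (Fin 2))` with finite lower integral is integrable. [folklore] -/
theorem integrable_of_continuous_of_nonneg₂ {g : (EuclideanSpace ℝ (Fin 2)) → ℝ} (hg : Continuous g)
    (h0 : ∀ x, 0 ≤ g x) (hfin : ∫⁻ x, ENNReal.ofReal (g x) < ⊤) : Integrable g volume := by
  refine ⟨hg.aestronglyMeasurable, ?_⟩
  rw [HasFiniteIntegral]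
  refine lt_of_le_of_lt (le_of_eq (lintegral_congr fun x => ?_)) hfin
  exact Real.enorm_eq_ofReal (h0 x)

/-- The Frobenius norm squared is a continuous function of the linear map (planar). [folklore] -/
theorem continuous_frobeniusNormSq_clm₂ {F : Type*} [NormedAddCommGroup F]
    [InnerProductSpace ℝ F] :
    Continuous fun L : (EuclideanSpace ℝ (Fin 2)) →L[ℝ] F => frobeniusNormSq L := by
  unfold frobeniusNormSq
  exact continuous_finsetSum _ fun i _ =>
    ((continuous_id.clm_apply continuous_const).norm).pow 2

/-- **Gradient-energy balance of a jointly smooth planar field on a closed slab**, under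
`L^∞_t L²_x` bounds on `∇u` and `∇∂ₜu` (verbatim planar twin of the tree's
`IsSmoothSpaceTimeOn.enstrophy_balance`): with `G(t) = ∫ |∇u(t)|²_F` and
`Φ(t) = ∫ 2 Σᵢ ⟪∂ᵢu(t), ∂ᵢ∂ₜu(t)⟫`, `Φ` is integrable on `(0, T)`, `G` is continuous on `[0, T]`,
and `G(b) = G(0) + ∫₀ᵇ Φ` for every `b ∈ (0, T]`. [folklore] -/
theorem gradEnergy_balance_of_bounds {T : ℝ} (hT : 0 < T)
    {u : ℝ → (EuclideanSpace ℝ (Fin 2)) → (EuclideanSpace ℝ (Fin 2))}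
    (hu : IsSmoothSpaceTimeOn (Icc 0 T) u) {C₁ C₂ : ℝ≥0}
    (hC₁ : ∀ t ∈ Icc 0 T, ∫⁻ x, ‖iteratedFDeriv ℝ 1 (u t) x‖ₑ ^ 2 ≤ C₁)
    (hC₂ : ∀ t ∈ Icc 0 T,
      ∫⁻ x, ‖iteratedFDeriv ℝ 1 (timeDerivWithin (Icc 0 T) u t) x‖ₑ ^ 2 ≤ C₂) :
    IntegrableOn (fun t => ∫ x, 2 * ∑ i, ⟪fderiv ℝ (u t) x (EuclideanSpace.basisFun (Fin 2) ℝ i),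
        fderiv ℝ (timeDerivWithin (Icc 0 T) u t) x (EuclideanSpace.basisFun (Fin 2) ℝ i)⟫)
      (Ioo 0 T) ∧
    ContinuousOn (fun t => ∫ x, frobeniusNormSq (fderiv ℝ (u t) x)) (Icc 0 T) ∧
    ∀ b ∈ Ioc 0 T, ∫ x, frobeniusNormSq (fderiv ℝ (u b) x) =
      (∫ x, frobeniusNormSq (fderiv ℝ (u 0) x)) +
        ∫ t in (0 : ℝ)..b, ∫ x, 2 * ∑ i, ⟪fderiv ℝ (u t) x (EuclideanSpace.basisFun (Fin 2) ℝ i),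
          fderiv ℝ (timeDerivWithin (Icc 0 T) u t) x (EuclideanSpace.basisFun (Fin 2) ℝ i)⟫ := by
  set e := EuclideanSpace.basisFun (Fin 2) ℝ with he
  have hU : UniqueDiffOn ℝ (Icc 0 T) := uniqueDiffOn_Icc hT
  set W : ℝ → (EuclideanSpace ℝ (Fin 2)) → (EuclideanSpace ℝ (Fin 2)) := timeDerivWithin (Icc 0 T) u with hW
  have hWsm : IsSmoothSpaceTimeOn (Icc 0 T) W := hu.timeDerivWithin hU
  -- joint continuity of `D(u t)(x)` and `D(W t)(x)`
  have cDu : ContinuousOn (fun z : ℝ × (EuclideanSpace ℝ (Fin 2)) => fderiv ℝ (u z.1) z.2) (Icc 0 T ×ˢ univ) :=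
    hu.continuousOn_fderiv_slice hU
  have cDW : ContinuousOn (fun z : ℝ × (EuclideanSpace ℝ (Fin 2)) => fderiv ℝ (W z.1) z.2) (Icc 0 T ×ˢ univ) :=
    hWsm.continuousOn_fderiv_slice hU
  -- the density `g t x = Σᵢ ⟪∂ᵢu, ∂ᵢW⟫` and the energy `G t = ∫ |∇u(t)|²`
  set g : ℝ → (EuclideanSpace ℝ (Fin 2)) → ℝ := fun t x =>
    ∑ i, ⟪fderiv ℝ (u t) x (e i), fderiv ℝ (W t) x (e i)⟫ with hg
  set G : ℝ → ℝ := fun t => ∫ x, frobeniusNormSq (fderiv ℝ (u t) x) with hG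
  have cg : ContinuousOn (uncurry g) (Icc 0 T ×ˢ univ) := by
    refine continuousOn_finsetSum _ fun i _ => ContinuousOn.inner ?_ ?_
    · exact cDu.clm_apply continuousOn_const
    · exact cDW.clm_apply continuousOn_const
  have cfrob : ContinuousOn (fun z : ℝ × (EuclideanSpace ℝ (Fin 2)) => frobeniusNormSq (fderiv ℝ (u z.1) z.2)) (Icc 0 T ×ˢ univ) :=
    continuous_frobeniusNormSq_clm₂.comp_continuousOn cDu
  have hcd : ∀ t ∈ Icc 0 T, ContDiff ℝ 1 (u t) := fun t ht => (hu.contDiff_slice ht).of_le (by norm_cast)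
  -- uniform `L²` bounds
  have hfrob_le : ∀ t ∈ Icc 0 T,
      ∫⁻ x, ENNReal.ofReal (frobeniusNormSq (fderiv ℝ (u t) x)) ≤ 2 * C₁ := by
    intro t ht
    calc ∫⁻ x, ENNReal.ofReal (frobeniusNormSq (fderiv ℝ (u t) x))
        ≤ ∫⁻ x, 2 * ‖iteratedFDeriv ℝ 1 (u t) x‖ₑ ^ 2 := lintegral_mono fun x => by
          rw [← ofReal_norm, norm_iteratedFDeriv_one, ofReal_norm]
          exact ofReal_frobeniusNormSq_le_two_mul_enorm_sq _
      _ = 2 * ∫⁻ x, ‖iteratedFDeriv ℝ 1 (u t) x‖ₑ ^ 2 := lintegral_const_mul' _ _ (by norm_num)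
      _ ≤ 2 * C₁ := by gcongr; exact hC₁ t ht
  have hfrob_lt : ∀ t ∈ Icc 0 T,
      ∫⁻ x, ENNReal.ofReal (frobeniusNormSq (fderiv ℝ (u t) x)) < ⊤ := fun t ht =>
    lt_of_le_of_lt (hfrob_le t ht) (ENNReal.mul_lt_top (by norm_num) ENNReal.coe_lt_top)
  have hDW_le : ∀ t ∈ Icc 0 T, ∫⁻ x, ‖fderiv ℝ (W t) x‖ₑ ^ 2 ≤ C₂ := fun t ht => by
    calc ∫⁻ x, ‖fderiv ℝ (W t) x‖ₑ ^ 2 = ∫⁻ x, ‖iteratedFDeriv ℝ 1 (W t) x‖ₑ ^ 2 :=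
          lintegral_congr fun x => by
            rw [← ofReal_norm, ← norm_iteratedFDeriv_one, ofReal_norm]
      _ ≤ C₂ := hC₂ t ht
  -- integrability of the slices of `|∇u|²`
  have ifrob : ∀ t ∈ Icc 0 T, Integrable (fun x => frobeniusNormSq (fderiv ℝ (u t) x)) volume :=
    fun t ht => integrable_of_continuous_of_nonneg₂
      (continuous_frobeniusNormSq_fderiv (hcd t ht) (by simp))
      (fun x => frobeniusNormSq_nonneg _) (hfrob_lt t ht)
  -- pointwise bound `|g| ≤ ‖Du‖² + ‖DW‖²` and integrability of `g` on `(0, T) × (EuclideanSpace ℝ (Fin 2))`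
  have hgle : ∀ t x, ‖g t x‖ ≤ 1 * (‖fderiv ℝ (u t) x‖ ^ 2 + ‖fderiv ℝ (W t) x‖ ^ 2) := by
    intro t x
    have h1 : ∀ i, ‖⟪fderiv ℝ (u t) x (e i), fderiv ℝ (W t) x (e i)⟫‖ ≤
        ‖fderiv ℝ (u t) x‖ * ‖fderiv ℝ (W t) x‖ := fun i =>
      (norm_inner_le_norm (𝕜 := ℝ) _ _).trans (mul_le_mul
        (by simpa [he] using (fderiv ℝ (u t) x).le_opNorm (e i))
        (by simpa [he] using (fderiv ℝ (W t) x).le_opNorm (e i)) (norm_nonneg _) (norm_nonneg _))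
    calc ‖g t x‖ ≤ ∑ i, ‖⟪fderiv ℝ (u t) x (e i), fderiv ℝ (W t) x (e i)⟫‖ := norm_sum_le _ _
      _ ≤ ∑ _i : Fin 2, ‖fderiv ℝ (u t) x‖ * ‖fderiv ℝ (W t) x‖ := Finset.sum_le_sum fun i _ => h1 i
      _ = 2 * (‖fderiv ℝ (u t) x‖ * ‖fderiv ℝ (W t) x‖) := by simp
      _ ≤ 1 * (‖fderiv ℝ (u t) x‖ ^ 2 + ‖fderiv ℝ (W t) x‖ ^ 2) := by
          nlinarith [sq_nonneg (‖fderiv ℝ (u t) x‖ - ‖fderiv ℝ (W t) x‖)]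
  have hg_lint : ∀ t ∈ Icc 0 T, ∫⁻ x, ‖g t x‖ₑ ≤ (1 : ℝ≥0∞) * (2 * C₁ + C₂) := by
    intro t ht
    have h32 : (1 : ℝ≥0∞) = ENNReal.ofReal 1 := by simp
    have hpt : ∀ x, ‖g t x‖ₑ ≤ (1 : ℝ≥0∞) * (‖fderiv ℝ (u t) x‖ₑ ^ 2 + ‖fderiv ℝ (W t) x‖ₑ ^ 2) := by
      intro x
      have hR : (1 : ℝ≥0∞) * (‖fderiv ℝ (u t) x‖ₑ ^ 2 + ‖fderiv ℝ (W t) x‖ₑ ^ 2) =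
          ENNReal.ofReal (1 * (‖fderiv ℝ (u t) x‖ ^ 2 + ‖fderiv ℝ (W t) x‖ ^ 2)) := by
        rw [ENNReal.ofReal_mul (by norm_num), ENNReal.ofReal_add (sq_nonneg _) (sq_nonneg _),
          ENNReal.ofReal_pow (norm_nonneg _), ENNReal.ofReal_pow (norm_nonneg _), ofReal_norm,
          ofReal_norm, h32]
      rw [hR, ← ofReal_norm]
      exact ENNReal.ofReal_le_ofReal (hgle t x)
    calc ∫⁻ x, ‖g t x‖ₑ ≤ ∫⁻ x, (1 : ℝ≥0∞) * (‖fderiv ℝ (u t) x‖ₑ ^ 2 + ‖fderiv ℝ (W t) x‖ₑ ^ 2) :=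
          lintegral_mono hpt
      _ = (1 : ℝ≥0∞) * ((∫⁻ x, ‖fderiv ℝ (u t) x‖ₑ ^ 2) + ∫⁻ x, ‖fderiv ℝ (W t) x‖ₑ ^ 2) := by
          rw [lintegral_const_mul' _ _ (by simp), lintegral_add_left']
          exact ((hcd t ht).continuous_fderiv (by simp)).aemeasurable.enorm.pow_const _
      _ ≤ (1 : ℝ≥0∞) * (2 * C₁ + C₂) := by
          gcongr
          · calc ∫⁻ x, ‖fderiv ℝ (u t) x‖ₑ ^ 2
                ≤ ∫⁻ x, ENNReal.ofReal (frobeniusNormSq (fderiv ℝ (u t) x)) :=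
                  lintegral_mono fun _ => enorm_sq_le_ofReal_frobeniusNormSq₂ _
              _ ≤ 2 * C₁ := hfrob_le t ht
          · exact hDW_le t ht
  have hKfin : (1 : ℝ≥0∞) * (2 * C₁ + C₂) ≠ ⊤ :=
    ENNReal.mul_ne_top (by simp)
      (ENNReal.add_ne_top.2 ⟨ENNReal.mul_ne_top (by norm_num) ENNReal.coe_ne_top, ENNReal.coe_ne_top⟩)
  have hg_int : ∀ b ∈ Ioc 0 T, Integrable (uncurry g)
      (((volume : Measure ℝ).restrict (Ioo 0 b)).prod volume) := by
    intro b hb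
    refine integrable_prod_of_continuousOn_of_lintegral
      (cg.mono (prod_mono (Icc_subset_Icc le_rfl hb.2) Subset.rfl)) ?_
    calc ∫⁻ t in Ioo 0 b, ∫⁻ x, ‖uncurry g (t, x)‖ₑ
        ≤ ∫⁻ _ in Ioo 0 b, (1 : ℝ≥0∞) * (2 * C₁ + C₂) :=
          setLIntegral_mono' measurableSet_Ioo fun t ht =>
            hg_lint t ⟨ht.1.le, ht.2.le.trans hb.2⟩
      _ < ⊤ := by
          rw [setLIntegral_const]
          exact ENNReal.mul_lt_top hKfin.lt_top (by simp)
  -- the time derivative of `|∇u(t, x)|²` at interior times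
  have hderiv : ∀ t ∈ Ioo 0 T, ∀ x, HasDerivAt (fun τ => frobeniusNormSq (fderiv ℝ (u τ) x))
      (2 * g t x) t := fun t ht x =>
    hasDerivAt_frobeniusNormSq₂ (hu.hasDerivAt_fderiv_slice_timeDerivWithin
      isOpen_Ioo Ioo_subset_Icc_self ht x)
  -- FTC in `t` for each `x`, on `[0, b]`
  have hFTC : ∀ b ∈ Ioc 0 T, ∀ x, ∫ t in (0 : ℝ)..b, 2 * g t x =
      frobeniusNormSq (fderiv ℝ (u b) x) - frobeniusNormSq (fderiv ℝ (u 0) x) := by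
    intro b hb x
    have hsub : Icc 0 b ⊆ Icc 0 T := Icc_subset_Icc le_rfl hb.2
    have hc : ContinuousOn (fun τ => ((τ, x) : ℝ × (EuclideanSpace ℝ (Fin 2)))) (Icc 0 b) :=
      (continuous_id.prodMk continuous_const).continuousOn
    have hmaps : MapsTo (fun τ => ((τ, x) : ℝ × (EuclideanSpace ℝ (Fin 2)))) (Icc 0 b)
        (Icc 0 T ×ˢ univ) := fun τ hτ => mk_mem_prod (hsub hτ) (mem_univ x)
    have hcont : ContinuousOn (fun τ => frobeniusNormSq (fderiv ℝ (u τ) x)) (Icc 0 b) :=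
      (cfrob.comp hc hmaps).congr fun τ _ => rfl
    have hcg : ContinuousOn (fun τ => g τ x) (Icc 0 b) := (cg.comp hc hmaps).congr fun τ _ => rfl
    have hcont' : ContinuousOn (fun τ => 2 * g τ x) (Icc 0 b) := continuousOn_const.mul hcg
    exact intervalIntegral.integral_eq_sub_of_hasDerivAt_of_le
      (f := fun τ => frobeniusNormSq (fderiv ℝ (u τ) x)) (f' := fun τ => 2 * g τ x) hb.1.le
      hcont (fun t ht => hderiv t ⟨ht.1, ht.2.trans_le hb.2⟩ x)
      (hcont'.intervalIntegrable_of_Icc hb.1.le)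
  -- Fubini: `G b - G 0 = ∫₀ᵇ ∫ 2 g`
  set φ : ℝ → ℝ := fun t => ∫ x, 2 * g t x with hφ
  have hφ_int : IntegrableOn φ (Ioo 0 T) volume :=
    ((hg_int T ⟨hT, le_rfl⟩).const_mul 2).integral_prod_left
  have hGb : ∀ b ∈ Ioc 0 T, G b = G 0 + ∫ t in (0 : ℝ)..b, φ t := by
    intro b hb
    have hI := (hg_int b hb).const_mul 2
    have hswap := integral_integral_swap (μ := (volume : Measure ℝ).restrict (Ioo 0 b))
      (ν := (volume : Measure (EuclideanSpace ℝ (Fin 2)))) (f := fun t x => 2 * g t x) hI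
    have hx : ∫ x, ∫ t in Ioo 0 b, 2 * g t x = G b - G 0 := by
      have : (fun x => ∫ t in Ioo 0 b, 2 * g t x) = fun x =>
          frobeniusNormSq (fderiv ℝ (u b) x) - frobeniusNormSq (fderiv ℝ (u 0) x) := by
        funext x
        rw [← hFTC b hb x, intervalIntegral.integral_of_le hb.1.le, integral_Ioc_eq_integral_Ioo]
      rw [this, integral_sub (ifrob b ⟨hb.1.le, hb.2⟩) (ifrob 0 ⟨le_rfl, hT.le⟩)]
    rw [intervalIntegral.integral_of_le hb.1.le, integral_Ioc_eq_integral_Ioo, hφ]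
    simp only
    rw [hswap, hx]
    ring
  -- continuity of `G` on `[0, T]`
  have hGcont : ContinuousOn G (Icc 0 T) := by
    have hprim : ContinuousOn (fun b => ∫ t in (0 : ℝ)..b, φ t) (Icc 0 T) := by
      have h := intervalIntegral.continuousOn_primitive_interval (μ := volume) (f := φ) (a := 0)
        (b := T) (by
          rw [uIcc_of_le hT.le]
          exact (hφ_int.congr_set_ae Ioo_ae_eq_Icc.symm))
      rwa [uIcc_of_le hT.le] at h
    have heq : ∀ b ∈ Icc 0 T, G b = G 0 + ∫ t in (0 : ℝ)..b, φ t := by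
      intro b hb
      rcases eq_or_lt_of_le hb.1 with h | h
      · rw [← h]; simp
      · exact hGb b ⟨h, hb.2⟩
    exact (continuousOn_const.add hprim).congr heq
  refine ⟨?_, hGcont, hGb⟩
  refine hφ_int.congr_fun (fun t _ => ?_) measurableSet_Ioo
  simp only [hφ, hg]

/-- **Gradient-energy balance of a uniformly Schwartz planar field on a closed slab.** For `u`
jointly smooth on `[0, T] × (EuclideanSpace ℝ (Fin 2))` with `HasUniformRapidDecayOn (Icc 0 T) u`:
`∫ |∇u(b)|²_F = ∫ |∇u(0)|²_F + ∫₀ᵇ ∫ 2 Σᵢ ⟪∂ᵢu, ∂ᵢ∂ₜu⟫` for every `b ∈ (0, T]`, and the inner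
time integrand is integrable on `(0, T)`. [folklore] -/
theorem gradEnergy_balance {T : ℝ} (hT : 0 < T) {u : ℝ → (EuclideanSpace ℝ (Fin 2)) → (EuclideanSpace ℝ (Fin 2))}
    (hu : IsSmoothSpaceTimeOn (Icc 0 T) u) (hd : HasUniformRapidDecayOn (Icc 0 T) u) :
    IntegrableOn (fun t => ∫ x, 2 * ∑ i, ⟪fderiv ℝ (u t) x (EuclideanSpace.basisFun (Fin 2) ℝ i),
        fderiv ℝ (timeDerivWithin (Icc 0 T) u t) x (EuclideanSpace.basisFun (Fin 2) ℝ i)⟫)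
      (Ioo 0 T) ∧
    ∀ b ∈ Ioc 0 T, ∫ x, frobeniusNormSq (fderiv ℝ (u b) x) =
      (∫ x, frobeniusNormSq (fderiv ℝ (u 0) x)) +
        ∫ t in (0 : ℝ)..b, ∫ x, 2 * ∑ i, ⟪fderiv ℝ (u t) x (EuclideanSpace.basisFun (Fin 2) ℝ i),
          fderiv ℝ (timeDerivWithin (Icc 0 T) u t) x (EuclideanSpace.basisFun (Fin 2) ℝ i)⟫ := by
  have hU : UniqueDiffOn ℝ (Icc 0 T) := uniqueDiffOn_Icc hT
  obtain ⟨C₁, hC₁⟩ := hd.exists_lintegral_iteratedFDeriv_slice_sq_le_Icc (μ := volume) hu hT 1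
  obtain ⟨C₂, hC₂⟩ := (hd.timeDerivWithin hu hU).exists_lintegral_iteratedFDeriv_slice_sq_le_Icc
    (μ := volume) (hu.timeDerivWithin hU) hT 1
  obtain ⟨h1, -, h3⟩ := gradEnergy_balance_of_bounds hT hu hC₁ hC₂
  exact ⟨h1, h3⟩

end TwoDimActionBound

end Summit.NavierStokesRegularity.NavierStokesRegularity.Theorems
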